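import Mathlib
import Summits.Ventures.PercRepro2.Defs
import Summits.Ventures.PercRepro2.Graph
import Summits.Ventures.PercRepro2.Induced
import Summits.Ventures.PercRepro2.VdBKahn
import Summits.Ventures.PercRepro2.ReimerVdBK
import Summits.Ventures.PercRepro2.ReimerVdBKTwisted
import Summits.Ventures.PercRepro2.ReimerVdBKTied
import Summits.Ventures.PercRepro2.ReimerVdBKCoreDown
import Summits.Ventures.PercRepro2.ReimerVdBKDegTwoCalc
import Summits.Ventures.PercRepro2.ReimerVdBKOuter
import Summits.Ventures.PercRepro2.ReimerVdBKPatch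
import Summits.Ventures.PercRepro2.ReimerVdBKOuterStars

/-!
# (OUTER-R) at `N = ∅` is Harris for every revealed set of one-world vertices
(blind cell PercRepro2, mine-c g49; `conjectures/MINE-C.md` §58 — part III; parts I–II: `ReimerVdBKPatch`,
`ReimerVdBKOuterStars`)

THEOREM `outerDown_of_subset_XY`: for every multigraph, every Harris pair `(A, X; B, Y)` (`X ∩ Y = ∅`) and
every revealed set `R ⊆ X ∪ Y` (vertices avoided by one world — the types `X`, `Y`, `A ∩ Y`, `B ∩ X`), the
fibre statement (OUTER-R) of `ReimerVdBKOuter` holds with `N = ∅`: on every outer fibre of `R` the two-world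
count of the left instance is at most that of the right instance.  Inner edges between revealed vertices
are allowed; `R = coreFree X Y ∅ = X ∪ Y` is the `N = ∅` slice of the statement of record (OUTER-𝓡)
(`MINE-C.md` §57.5, `outerDown_coreFree_of_empty_N`); `R = {v}` is the one-world pattern theorem of §57.6
for every degree of `v` (`outerDown_singleton_of_mem_X`, `outerDown_singleton_of_mem_Y`).

The proof is the crosswise / pattern-to-pattern pairing of `MINE-C.md` §57.6 made uniform.  On the sub-cube
of a pattern `d` the left event is `U₁ ∩ bar U₂` for two upper sets of the free cube
(`preimage_twoWorld_eq`); Harris (`count_inter_bar_le_count_inter`) gives `#(U₁ ∩ bar U₂) ≤ #(U₁ ∩ U₂)`;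
and `U₁ ∩ U₂` lies inside the right-hand event on the sub-cube of the PAIRED pattern `flipOn FX d` (the
outer stars of `R ∩ X` flipped, those of `R ∖ X` kept; `upOne_inter_upTwo_subset`): the world-1 part by
monotonicity, the world-2 part by the closure lemma `conn_iff_of_closed_stars` — the world-2 cluster of
the paired pattern equals the cluster with every revealed star closed, because each revealed vertex is
outside the cluster of the pattern that agrees with the paired pattern on its own star.  Summing the
per-pattern inequalities over the patterns of the fibre (`mul_count_inter_eq_sum_onF`) and reindexing by
the involution `flipOn FX` (which preserves the fibre) gives the fibre inequality
(`count_inter_outerFibre_le`).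
-/

namespace Summit.Ventures.PercRepro2
namespace ReimerVdBK
open Classical

variable {V : Type*} {E : Type*} [Fintype E] [DecidableEq E] [Fintype V] [DecidableEq V]

section Main
variable (ends : E → Sym2 V) (s : V) (A X B Y R : Finset V)

/-- **`U₁(d) ∩ U₂(d)` lies in the right event on the sub-cube of the paired pattern** `flipOn FX d` (the
outer stars of `R ∩ X` flipped, those of `R ∖ X` kept). -/
lemma upOne_inter_upTwo_subset (d : Config E) :
    upOne ends s A X Y R d ∩ upTwo ends s X B R d ⊆
      patch (FE ends R) (flipOn (FX ends X R) d) ⁻¹' twoWorld ends s (A ∪ B) ∅ ∅ (X ∪ Y) := by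
  rintro ω'' ⟨⟨⟨hA, hRY⟩, hY'⟩, ⟨hRX, hX'⟩, hB⟩
  simp only [Set.mem_preimage, mem_bar, connAll, avoidAll, Set.mem_setOf_eq, compl_patch, compl_compl] at hA hRY hY' hRX hX' hB
  simp only [Set.mem_preimage, twoWorld, Set.mem_inter_iff, mem_bar, connAll, avoidAll, Set.mem_setOf_eq,
    compl_patch, compl_flipOn, Finset.notMem_empty, IsEmpty.forall_iff, implies_true, true_and, and_true]
  -- the world-2 configuration of the paired pattern and its all-closed minorant
  set η := patch (FE ends R) (flipOn (FX ends X R) (compl d)) (compl ω'') with hη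
  set η₀ := patch (FE ends R) (setOn (FE ends R) false (compl d)) (compl ω'') with hη₀
  have hle : η₀ ≤ η := by
    refine patch_le_patch _ (fun e he => ?_) _
    rw [setOn_of_mem _ he]
    exact Bool.false_le _
  have hoff : ∀ e, (∀ w ∈ R, w ∉ ends e) → η₀ e = η e := by
    intro e he
    have hF : e ∉ FE ends R := not_mem_outerEdges_of_not_incident ends R he
    rw [hη, hη₀, patch_of_not_mem _ hF, patch_of_not_mem _ hF]
  have hW : ∀ w ∈ R, ∃ ηw : Config E, η₀ ≤ ηw ∧ (∀ e, w ∈ ends e → ηw e = η e) ∧ ¬ Conn ends ηw s w := by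
    intro w hw
    by_cases hwX : w ∈ X
    · refine ⟨patch (FE ends R) d (compl ω''), ?_, ?_, hRX w (Finset.mem_inter.2 ⟨hw, hwX⟩)⟩
      · refine patch_le_patch _ (fun e he => ?_) _
        rw [setOn_of_mem _ he]
        exact Bool.false_le _
      · intro e hwe
        by_cases hF : e ∈ FE ends R
        · have hFX : e ∈ FX ends X R :=
            (mem_outerEdges_iff ends R).2 ⟨w, Finset.mem_inter.2 ⟨hw, hwX⟩, mem_outerStar_of_mem_FE ends R hw hF hwe⟩
          rw [hη, patch_of_mem _ hF, patch_of_mem _ hF, flipOn_of_mem _ hFX]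
          simp [compl]
        · rw [hη, patch_of_not_mem _ hF, patch_of_not_mem _ hF]
    · refine ⟨patch (FE ends R) (compl d) (compl ω''), ?_, ?_, hRY w (Finset.mem_sdiff.2 ⟨hw, hwX⟩)⟩
      · refine patch_le_patch _ (fun e he => ?_) _
        rw [setOn_of_mem _ he]
        exact Bool.false_le _
      · intro e hwe
        by_cases hF : e ∈ FE ends R
        · have hFX : e ∉ FX ends X R := by
            intro h
            exact hwX ((Finset.mem_inter.1 ((mem_outerEdges_iff_of_mem_outerStar ends R hw
              (mem_outerStar_of_mem_FE ends R hw hF hwe)).1 h)).2)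
          rw [hη, patch_of_mem _ hF, patch_of_mem _ hF, flipOn_of_not_mem _ hFX]
        · rw [hη, patch_of_not_mem _ hF, patch_of_not_mem _ hF]
  have hcl := conn_iff_of_closed_stars ends s R hle hoff hW
  refine ⟨fun a ha => ?_, fun y hy => ?_⟩
  · -- world 1: `A ∪ B` connected under the paired pattern
    rcases Finset.mem_union.1 ha with haA | haB
    · refine conn_mono (patch_le_patch _ (fun e _ => ?_) ω'') (hA a haA)
      by_cases he : e ∈ FX ends X R
      · rw [setOn_of_mem _ he]
        exact Bool.false_le _
      · rw [setOn_of_not_mem _ he, flipOn_of_not_mem _ he]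
    · refine conn_mono (patch_le_patch _ (fun e he => ?_) ω'') (hB a haB)
      rw [compl_setOn]
      by_cases heY : e ∈ FY ends X R
      · rw [setOn_of_mem _ heY]
        exact Bool.false_le _
      · rw [setOn_of_not_mem _ heY]
        rcases mem_FX_or_FY ends X R he with heX | heY'
        · rw [flipOn_of_mem _ heX]
          exact le_of_eq rfl
        · exact absurd heY' heY
  · -- world 2: `X ∪ Y` avoided under the paired pattern
    intro hcon
    have h0 : Conn ends η₀ s y := (hcl y).1 hcon
    have hmin : ∀ d' : Config E, η₀ ≤ patch (FE ends R) d' (compl ω'') := by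
      intro d'
      refine patch_le_patch _ (fun e he => ?_) _
      rw [setOn_of_mem _ he]
      exact Bool.false_le _
    by_cases hyR : y ∈ R
    · by_cases hyX : y ∈ X
      · exact hRX y (Finset.mem_inter.2 ⟨hyR, hyX⟩) (conn_mono (hmin d) h0)
      · exact hRY y (Finset.mem_sdiff.2 ⟨hyR, hyX⟩) (conn_mono (hmin (compl d)) h0)
    · rcases Finset.mem_union.1 hy with hyX | hyY
      · exact hX' y (Finset.mem_sdiff.2 ⟨hyX, hyR⟩) (conn_mono (hmin _) h0)
      · exact hY' y (Finset.mem_sdiff.2 ⟨hyY, hyR⟩) (conn_mono (hmin _) h0)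

/-- **The per-pattern inequality**: the left count on the sub-cube of `d` is at most the right count on the
sub-cube of the paired pattern — Harris (`count_inter_bar_le_count_inter`) on the free cube. -/
lemma count_preimage_le (hR : R ⊆ X ∪ Y) (hXY : X ∩ Y = ∅) (d : Config E) :
    count (patch (FE ends R) d ⁻¹' twoWorld ends s A X B Y) ≤
      count (patch (FE ends R) (flipOn (FX ends X R) d) ⁻¹' twoWorld ends s (A ∪ B) ∅ ∅ (X ∪ Y)) := by
  rw [preimage_twoWorld_eq ends s A X B Y R hR hXY d]
  calc count (upOne ends s A X Y R d ∩ bar (upTwo ends s X B R d))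
      ≤ count (upOne ends s A X Y R d ∩ upTwo ends s X B R d) :=
        count_inter_bar_le_count_inter (isUpperSet_upOne ends s A X Y R d) (isUpperSet_upTwo ends s X B R d)
    _ ≤ count (patch (FE ends R) (flipOn (FX ends X R) d) ⁻¹' twoWorld ends s (A ∪ B) ∅ ∅ (X ∪ Y)) :=
        count_mono (upOne_inter_upTwo_subset ends s A X B Y R d)

/-- **The per-pattern inequality in sub-cube form**: the left count on the sub-cube of the pattern `d` is at
most the right count on the sub-cube of the paired pattern (the outer stars of `R ∩ X` flipped).  This is the
statement the census of `MINE-C.md` §58.3 shows to be EXACTLY the `N = ∅` boundary: with core weights it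
fails already for a single revealed vertex, while its sum over the fibre survives. -/
theorem count_onF_twoWorld_le (hR : R ⊆ X ∪ Y) (hXY : X ∩ Y = ∅) (d : Config E) :
    count (twoWorld ends s A X B Y ∩ onF (FE ends R) d) ≤
      count (twoWorld ends s (A ∪ B) ∅ ∅ (X ∪ Y) ∩ onF (FE ends R) (flipOn (FX ends X R) d)) := by
  rw [count_inter_onF_eq, count_inter_onF_eq]
  exact count_preimage_le ends s A X B Y R hR hXY d

/-- The free cube is nonempty. -/
lemma count_univ_pos : 0 < count (Set.univ : Set (Config {e : E // e ∉ FE ends R})) := by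
  unfold count
  exact Finset.sum_pos' (fun ω _ => by split_ifs <;> omega)
    ⟨fun _ => false, Finset.mem_univ _, by simp⟩

/-- **The fibre inequality at `N = ∅`**: on every outer fibre of `R ⊆ X ∪ Y` the two-world count of the
left instance is at most that of the right instance. -/
theorem count_inter_outerFibre_le (hR : R ⊆ X ∪ Y) (hXY : X ∩ Y = ∅) (c : Config E) :
    count (twoWorld ends s A X B Y ∩ outerFibre ends c R) ≤
      count (twoWorld ends s (A ∪ B) ∅ ∅ (X ∪ Y) ∩ outerFibre ends c R) := by
  have hFib : ∀ ω ω' : Config E, (∀ e ∈ FE ends R, ω e = ω' e) → ω ∈ outerFibre ends c R →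
      ω' ∈ outerFibre ends c R := fun ω ω' h hω => mem_outerFibre_of_agree ends R h hω
  have h1 := mul_count_inter_eq_sum_onF (FE ends R) (twoWorld ends s A X B Y) (outerFibre ends c R) hFib
  have h2 := mul_count_inter_eq_sum_onF (FE ends R) (twoWorld ends s (A ∪ B) ∅ ∅ (X ∪ Y))
    (outerFibre ends c R) hFib
  refine Nat.le_of_mul_le_mul_left ?_ (count_univ_pos ends R)
  rw [h1, h2]
  have h3 : ∀ d : Config E,
      (if d ∈ outerFibre ends c R then count (twoWorld ends s A X B Y ∩ onF (FE ends R) d) else 0) ≤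
        (if d ∈ outerFibre ends c R then
          count (twoWorld ends s (A ∪ B) ∅ ∅ (X ∪ Y) ∩ onF (FE ends R) (flipOn (FX ends X R) d)) else 0) := by
    intro d
    split_ifs with hd
    · rw [count_inter_onF_eq, count_inter_onF_eq]
      exact count_preimage_le ends s A X B Y R hR hXY d
    · exact le_refl 0
  calc ∑ d : Config E, (if d ∈ outerFibre ends c R then count (twoWorld ends s A X B Y ∩ onF (FE ends R) d) else 0)
      ≤ ∑ d : Config E, (if d ∈ outerFibre ends c R then
          count (twoWorld ends s (A ∪ B) ∅ ∅ (X ∪ Y) ∩ onF (FE ends R) (flipOn (FX ends X R) d)) else 0) :=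
        Finset.sum_le_sum fun d _ => h3 d
    _ = ∑ d : Config E, (if flipOn (FX ends X R) d ∈ outerFibre ends c R then
          count (twoWorld ends s (A ∪ B) ∅ ∅ (X ∪ Y) ∩ onF (FE ends R) (flipOn (FX ends X R) d)) else 0) := by
        refine Finset.sum_congr rfl fun d _ => ?_
        rw [show flipOn (FX ends X R) d ∈ outerFibre ends c R ↔ d ∈ outerFibre ends c R from
          flipOn_mem_outerFibre_iff ends R (R ∩ X) c d]
    _ = ∑ d : Config E, (if d ∈ outerFibre ends c R then
          count (twoWorld ends s (A ∪ B) ∅ ∅ (X ∪ Y) ∩ onF (FE ends R) d) else 0) :=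
        Equiv.sum_comp (Function.Involutive.toPerm _ (flipOn_involutive (FX ends X R)))
          (fun d => if d ∈ outerFibre ends c R then
            count (twoWorld ends s (A ∪ B) ∅ ∅ (X ∪ Y) ∩ onF (FE ends R) d) else 0)

/-- With `N = ∅` the outer count is the two-world count on the outer fibre. -/
lemma outerCount_empty_N (c : Config E) :
    outerCount ends s A X B Y ∅ R c = count (twoWorld ends s A X B Y ∩ outerFibre ends c R) := by
  unfold outerCount count
  refine Finset.sum_congr rfl fun ω _ => ?_
  have hca : CoreAvoid ends s (∅ : Finset V) ω := fun w hw => absurd hw (Finset.notMem_empty w)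
  simp only [hca, true_and, Set.mem_inter_iff]

/-- **(OUTER-R) at `N = ∅` for every revealed set of one-world vertices** (`MINE-C.md` §58): for a Harris
pair `(A, X; B, Y)` (`X ∩ Y = ∅`) and every `R ⊆ X ∪ Y`, every outer fibre of `R` satisfies the two-world
inequality.  Inner edges between revealed vertices are allowed; the types `A ∩ Y ⊆ Y` and `B ∩ X ⊆ X` are
included. -/
theorem outerDown_of_subset_XY (hR : R ⊆ X ∪ Y) (hXY : X ∩ Y = ∅) : OuterDown ends s A X B Y ∅ R := by
  intro c
  rw [outerCount_empty_N, outerCount_empty_N]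
  exact count_inter_outerFibre_le ends s A X B Y R hR hXY c

/-- **(OUTER-𝓡) at `N = ∅`**: the `N = ∅` slice of the statement of record of `MINE-C.md` §57.5 is a theorem
on every multigraph. -/
theorem outerDown_coreFree_of_empty_N (hXY : X ∩ Y = ∅) :
    OuterDown ends s A X B Y ∅ (coreFree X Y ∅) :=
  outerDown_of_subset_XY ends s A X B Y (coreFree X Y ∅) (by simp [coreFree]) hXY

/-- **(OUTER-{v}) at `N = ∅` for a vertex avoided by world 1** (`v ∈ X`, the types `X` and `B ∩ X`): every
pattern class of the star of `v` is Harris, for every degree of `v` (`MINE-C.md` §57.6). -/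
theorem outerDown_singleton_of_mem_X {v : V} (hv : v ∈ X) (hXY : X ∩ Y = ∅) :
    OuterDown ends s A X B Y ∅ {v} :=
  outerDown_of_subset_XY ends s A X B Y {v}
    (Finset.singleton_subset_iff.2 (Finset.mem_union_left Y hv)) hXY

/-- **(OUTER-{v}) at `N = ∅` for a vertex avoided by world 2** (`v ∈ Y`, the types `Y` and `A ∩ Y`). -/
theorem outerDown_singleton_of_mem_Y {v : V} (hv : v ∈ Y) (hXY : X ∩ Y = ∅) :
    OuterDown ends s A X B Y ∅ {v} :=
  outerDown_of_subset_XY ends s A X B Y {v}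
    (Finset.singleton_subset_iff.2 (Finset.mem_union_right X hv)) hXY

end Main

end ReimerVdBK
end Summit.Ventures.PercRepro2
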